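import Summits.ResolutionOfSingularities.ResolutionOfSingularities.Theorems.RadicialJungCleanModelsSufficeGameEndPoint

/-!
# Route `RadicialJung`, crux `CleanModelsSuffice`, line `Sketch`: the END STATE of the game at a
# toroidal point — the charged divisors and the normalised Kummer data

Helper for the registered stub `stub_gameEndResolves` of the skeleton of
`Summit.ResolutionOfSingularities.ResolutionOfSingularities.Theses.RadicialJung.CleanModelsSuffice`
(stmt-ResolutionOfSingularities-15883). At a point `v ∈ S.tor` of the toroidal locus of an end
state (`mOld v = 0` there, so every charged coordinate is the label of a charged exceptional divisor
`divOf k`, `k < #charged = nC v + 1`) this file builds the NORMALISED, UNIT-ABSORBED Kummer data of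
the chart at `v`: `yN v ∈ L ∖ K(V)`, exponents `aK v` (`aK 0 = 1`, `1 ≤ aK < p`, `aK ≡ cN · a`) and
boundary germs `b v k` (associated to the charged coordinates, generating the stalks of the
`divOf k`, part of a regular system of parameters) with `yN^p = ∏ (b k)^{aK k}` in `L`
(`stub_normalizeExponents` applied to the charged coordinates and the unit `w_v` with exponent `1`,
then `w_v^{a'}` absorbed into `b 0`).
-/

noncomputable section

set_option linter.dupNamespace false -- mandated namespace of this single-conjunct summit

open CategoryTheory AlgebraicGeometry TopologicalSpace IsLocalRing
open Literature.AlgebraicGeometry.Resolution Literature.AlgebraicGeometry.Motives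

namespace Summit.ResolutionOfSingularities.ResolutionOfSingularities.Theorems.RadicialJung.CleanModelsSuffice

attribute [local instance] stalkAlgebra isScalarTower_stalkAlgebra

namespace GameState

variable {p : ℕ} {V₀ : Scheme.{0}} [IsIntegral V₀] {L : Type} [Field L] [Algebra V₀.functionField L]
  {V : Scheme.{0}} [IsIntegral V] {π : V ⟶ V₀} [IsDominant π] (S : GameState p V₀ L V π)

/-! ## Toroidal points: the charged divisors -/

section Tor

/-- The number of charged coordinates minus one (so that the charged coordinates of a toroidal
point are indexed by `Fin (nC v + 1)`). [folklore] -/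
def nC (S : GameState p V₀ L V π) (v : V) : ℕ :=
  (S.ch v).card - 1

/-- A toroidal point has `nC v + 1` charged coordinates. [folklore] -/
theorem card_ch_eq {v : V} (hv : v ∈ S.tor) : (S.ch v).card = S.nC v + 1 := by
  obtain ⟨D, hD⟩ := hv
  obtain ⟨h, ha⟩ := (S.chargedAt_iff D v).mp hD
  have hpos : 0 < (S.ch v).card := Finset.card_pos.mpr ⟨_, (S.mem_ch_iff v _).mpr ha⟩
  unfold nC
  omega

/-- The charged coordinates of a toroidal point, enumerated increasingly. [folklore] -/
def eC (S : GameState p V₀ L V π) {v : V} (hv : v ∈ S.tor) : Fin (S.nC v + 1) ↪o Fin (S.d v) :=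
  (S.ch v).orderEmbOfFin (S.card_ch_eq hv)

/-- The enumerated coordinates are charged. [folklore] -/
theorem eC_mem {v : V} (hv : v ∈ S.tor) (k : Fin (S.nC v + 1)) : S.eC hv k ∈ S.ch v :=
  Finset.orderEmbOfFin_mem _ _ k

/-- The enumerated coordinates have nonzero exponent. [folklore] -/
theorem a_eC_ne_zero {v : V} (hv : v ∈ S.tor) (k : Fin (S.nC v + 1)) : S.a v (S.eC hv k) ≠ 0 :=
  (S.mem_ch_iff v _).mp (S.eC_mem hv k)

/-- Every charged coordinate is enumerated. [folklore] -/
theorem exists_eC_eq {v : V} (hv : v ∈ S.tor) {i : Fin (S.d v)} (hi : S.a v i ≠ 0) :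
    ∃ k, S.eC hv k = i := by
  have h : i ∈ Set.range (S.eC hv) := by
    rw [eC, Finset.range_orderEmbOfFin]
    exact (S.mem_ch_iff v i).mpr hi
  exact h

/-- The exceptional divisor labelled by the `k`-th charged coordinate (end state: every charged
coordinate of a toroidal point is a label). [folklore] -/
def divOf (S : GameState p V₀ L V π) (hend : S.EndCond) {v : V} (hv : v ∈ S.tor)
    (k : Fin (S.nC v + 1)) : {D : V.IdealSheafData // D ∈ S.E ∧ v ∈ D.support} :=
  (S.isLab_of_mem_ch hend hv (S.eC_mem hv k)).choose

/-- `divOf k` is labelled by the `k`-th charged coordinate. [folklore] -/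
theorem lab_divOf (hend : S.EndCond) {v : V} (hv : v ∈ S.tor) (k : Fin (S.nC v + 1)) :
    S.lab v (S.divOf hend hv k) = S.eC hv k :=
  (S.isLab_of_mem_ch hend hv (S.eC_mem hv k)).choose_spec

/-- Distinct charged coordinates label distinct divisors. [folklore] -/
theorem divOf_injective (hend : S.EndCond) {v : V} (hv : v ∈ S.tor) :
    Function.Injective (S.divOf hend hv) := fun k k' h =>
  (S.eC hv).injective (by rw [← S.lab_divOf hend hv k, ← S.lab_divOf hend hv k', h])

/-- The stalk of `divOf k` at `v` is generated by the `k`-th charged coordinate. [folklore] -/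
theorem stalkIdeal_divOf (hend : S.EndCond) {v : V} (hv : v ∈ S.tor) (k : Fin (S.nC v + 1)) :
    stalkIdeal (S.divOf hend hv k).1 v = Ideal.span {S.u v (S.eC hv k)} := by
  rw [S.stalkIdeal_lab v, S.lab_divOf hend hv k]

/-- The exponent of `divOf k` at `v` is that of the `k`-th charged coordinate. [folklore] -/
theorem expOf_divOf (hend : S.EndCond) {v : V} (hv : v ∈ S.tor) (k : Fin (S.nC v + 1)) :
    S.expOf (S.divOf hend hv k).1 v = S.a v (S.eC hv k) := by
  unfold expOf
  rw [dif_pos (S.divOf hend hv k).2, Subtype.coe_eta, S.lab_divOf hend hv k]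

/-- `divOf k` is charged at `v`. [folklore] -/
theorem chargedAt_divOf (hend : S.EndCond) {v : V} (hv : v ∈ S.tor) (k : Fin (S.nC v + 1)) :
    S.chargedAt (S.divOf hend hv k).1 v := by
  rw [chargedAt, S.expOf_divOf hend hv k]
  exact S.a_eC_ne_zero hv k

/-- Every exceptional divisor charged at a toroidal point is one of the `divOf k`. [folklore] -/
theorem exists_divOf_eq (hend : S.EndCond) {v : V} (hv : v ∈ S.tor) {D : V.IdealSheafData}
    (hD : S.chargedAt D v) : ∃ k, (S.divOf hend hv k).1 = D := by
  obtain ⟨h, ha⟩ := (S.chargedAt_iff D v).mp hD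
  obtain ⟨k, hk⟩ := S.exists_eC_eq hv ha
  refine ⟨k, ?_⟩
  have h1 : S.lab v (S.divOf hend hv k) = S.lab v ⟨D, h⟩ := by rw [S.lab_divOf hend hv k, hk]
  exact congrArg Subtype.val (S.lab_injective v h1)

end Tor

/-! ## Toroidal points: the normalised, unit-absorbed Kummer data -/

section Kummer

variable [Algebra V.functionField L]

/-- The input of the normalisation: the charged coordinates followed by the unit `w_v`.
[folklore] -/
def tIn (S : GameState p V₀ L V π) {v : V} (hv : v ∈ S.tor) : Fin (S.nC v + 1 + 1) → V.presheaf.stalk v :=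
  Fin.snoc (fun k => S.u v (S.eC hv k)) (S.w v)

/-- Their exponents: the charged exponents followed by `1`. [folklore] -/
def aIn (S : GameState p V₀ L V π) {v : V} (hv : v ∈ S.tor) : Fin (S.nC v + 1 + 1) → ℕ :=
  Fin.snoc (fun k => S.a v (S.eC hv k)) 1

omit [Algebra V.functionField L] in
/-- The inputs of the normalisation are nonzero. [folklore] -/
theorem tIn_ne_zero {v : V} (hv : v ∈ S.tor) (i : Fin (S.nC v + 1 + 1)) : S.tIn hv i ≠ 0 := by
  haveI := S.isRegular v
  induction i using Fin.lastCases with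
  | last => rw [tIn, Fin.snoc_last]; exact (S.isUnit_w v).ne_zero
  | cast k => rw [tIn, Fin.snoc_castSucc]; exact (RoundOff.isRsopPart_u S v).ne_zero _

omit [Algebra V.functionField L] in
/-- The input exponents are prime to `p`. [folklore] -/
theorem not_dvd_aIn (hp : p.Prime) {v : V} (hv : v ∈ S.tor) (i : Fin (S.nC v + 1 + 1)) :
    ¬ p ∣ S.aIn hv i := by
  induction i using Fin.lastCases with
  | last => rw [aIn, Fin.snoc_last]; exact hp.one_lt.ne' ∘ Nat.eq_one_of_dvd_one
  | cast k =>
    rw [aIn, Fin.snoc_castSucc]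
    exact (S.a_spec v _).resolve_left (S.a_eC_ne_zero hv k)

omit [Algebra V.functionField L] in
/-- The radicand is the product of the inputs to their exponents. [folklore] -/
theorem prod_tIn_pow {v : V} (hv : v ∈ S.tor) :
    ∏ i, S.tIn hv i ^ S.aIn hv i = S.w v * ∏ i, S.u v i ^ S.a v i := by
  rw [Fin.prod_univ_castSucc]
  simp only [tIn, aIn, Fin.snoc_castSucc, Fin.snoc_last, pow_one]
  rw [mul_comm]
  congr 1
  -- the product over all coordinates is the product over the charged ones
  symm
  calc ∏ i, S.u v i ^ S.a v i = ∏ i ∈ S.ch v, S.u v i ^ S.a v i := by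
        refine (Finset.prod_subset (Finset.subset_univ _) fun i _ hi => ?_).symm
        rw [show S.a v i = 0 from not_not.mp ((S.mem_ch_iff v i).not.mp hi), pow_zero]
    _ = ∏ k : Fin (S.nC v + 1), S.u v (S.eC hv k) ^ S.a v (S.eC hv k) := by
        rw [← Finset.prod_coe_sort]
        exact (Fintype.prod_equiv ((S.ch v).orderIsoOfFin (S.card_ch_eq hv)).toEquiv _ _
          (fun k => by simp [eC, Finset.coe_orderIsoOfFin_apply])).symm

/-- `y_v^p = ∏ tInᵢ^{aInᵢ}` in `L`. [folklore] -/
theorem y_pow_tIn (H : S.EndHyp) {v : V} (hv : v ∈ S.tor) :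
    S.y v ^ p = algebraMap (V.presheaf.stalk v) L (∏ i, S.tIn hv i ^ S.aIn hv i) := by
  rw [S.prod_tIn_pow hv, S.y_pow_stalk H v]

/-- **Normalising the exponents at a toroidal point** (`stub_normalizeExponents` in `𝒪_{V,v}`):
`y'`, `a'` with `a'₀ = 1`, `1 ≤ a'ᵢ < p`, `a' ≡ c · aIn` and `y'^p = ∏ tInᵢ^{a'ᵢ}`. [folklore] -/
theorem exists_normalized (H : S.EndHyp) {v : V} (hv : v ∈ S.tor) :
    ∃ (y' : L) (a' : Fin (S.nC v + 1 + 1) → ℕ) (c : ℕ),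
      y' ∉ Set.range (algebraMap V.functionField L) ∧ a' 0 = 1 ∧ (∀ i, 1 ≤ a' i ∧ a' i < p) ∧
      ¬ p ∣ c ∧ (∀ i, a' i ≡ c * S.aIn hv i [MOD p]) ∧
      y' ^ p = algebraMap (V.presheaf.stalk v) L (∏ i, S.tIn hv i ^ a' i) :=
  haveI := H.charP
  stub_normalizeExponents p H.prime H.finrank (S.nC v + 1) (S.tIn hv) (S.tIn_ne_zero hv) (S.aIn hv)
    (S.not_dvd_aIn H.prime hv) (S.y v) (S.y_not_mem_range H v) (S.y_pow_tIn H hv)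

/-- The normalised generator `yN v`. [folklore] -/
def yN (S : GameState p V₀ L V π) (H : S.EndHyp) {v : V} (hv : v ∈ S.tor) : L :=
  (S.exists_normalized H hv).choose

/-- The normalised exponents (including the exponent of the unit). [folklore] -/
def aN (S : GameState p V₀ L V π) (H : S.EndHyp) {v : V} (hv : v ∈ S.tor) :
    Fin (S.nC v + 1 + 1) → ℕ :=
  (S.exists_normalized H hv).choose_spec.choose

/-- The normalising multiplier. [folklore] -/
def cN (S : GameState p V₀ L V π) (H : S.EndHyp) {v : V} (hv : v ∈ S.tor) : ℕ :=
  (S.exists_normalized H hv).choose_spec.choose_spec.choose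

/-- The properties of the normalised data. [folklore] -/
theorem normalized_spec (H : S.EndHyp) {v : V} (hv : v ∈ S.tor) :
    S.yN H hv ∉ Set.range (algebraMap V.functionField L) ∧ S.aN H hv 0 = 1 ∧
      (∀ i, 1 ≤ S.aN H hv i ∧ S.aN H hv i < p) ∧ ¬ p ∣ S.cN H hv ∧
      (∀ i, S.aN H hv i ≡ S.cN H hv * S.aIn hv i [MOD p]) ∧
      S.yN H hv ^ p = algebraMap (V.presheaf.stalk v) L (∏ i, S.tIn hv i ^ S.aN H hv i) :=
  (S.exists_normalized H hv).choose_spec.choose_spec.choose_spec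

/-- The Kummer exponents `aK v` of the chart at `v` (drop the exponent of the unit). [folklore] -/
def aK (S : GameState p V₀ L V π) (H : S.EndHyp) {v : V} (hv : v ∈ S.tor) : Fin (S.nC v + 1) → ℕ :=
  fun k => S.aN H hv (Fin.castSucc k)

/-- The boundary germs `b v k` of the chart at `v`: the charged coordinates, the first one
multiplied by `w_v^{a'_last}` (absorbing the unit). [folklore] -/
def b (S : GameState p V₀ L V π) (H : S.EndHyp) {v : V} (hv : v ∈ S.tor) (k : Fin (S.nC v + 1)) :
    V.presheaf.stalk v :=
  if k = 0 then S.w v ^ S.aN H hv (Fin.last _) * S.u v (S.eC hv k) else S.u v (S.eC hv k)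

/-- `aK 0 = 1`. [folklore] -/
theorem aK_zero (H : S.EndHyp) {v : V} (hv : v ∈ S.tor) : S.aK H hv 0 = 1 :=
  (S.normalized_spec H hv).2.1

/-- `1 ≤ aK k < p`. [folklore] -/
theorem aK_bounds (H : S.EndHyp) {v : V} (hv : v ∈ S.tor) (k : Fin (S.nC v + 1)) :
    1 ≤ S.aK H hv k ∧ S.aK H hv k < p :=
  (S.normalized_spec H hv).2.2.1 _

/-- `yN ∉ K(V)`. [folklore] -/
theorem yN_not_mem (H : S.EndHyp) {v : V} (hv : v ∈ S.tor) :
    S.yN H hv ∉ Set.range (algebraMap V.functionField L) :=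
  (S.normalized_spec H hv).1

/-- `yN ≠ 0`. [folklore] -/
theorem yN_ne_zero (H : S.EndHyp) {v : V} (hv : v ∈ S.tor) : S.yN H hv ≠ 0 := fun h =>
  S.yN_not_mem H hv ⟨0, by rw [map_zero, h]⟩

/-- The normalising multiplier is prime to `p`. [folklore] -/
theorem not_dvd_cN (H : S.EndHyp) {v : V} (hv : v ∈ S.tor) : ¬ p ∣ S.cN H hv :=
  (S.normalized_spec H hv).2.2.2.1

/-- `aK k ≡ cN · a (eC k) (mod p)`. [folklore] -/
theorem aK_modEq (H : S.EndHyp) {v : V} (hv : v ∈ S.tor) (k : Fin (S.nC v + 1)) :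
    S.aK H hv k ≡ S.cN H hv * S.a v (S.eC hv k) [MOD p] := by
  have h := (S.normalized_spec H hv).2.2.2.2.1 (Fin.castSucc k)
  rwa [aIn, Fin.snoc_castSucc] at h

/-- The boundary germs are associated to the charged coordinates. [folklore] -/
theorem associated_b (H : S.EndHyp) {v : V} (hv : v ∈ S.tor) (k : Fin (S.nC v + 1)) :
    Associated (S.b H hv k) (S.u v (S.eC hv k)) := by
  unfold b
  split_ifs with h
  · exact associated_unit_mul_left _ _ ((S.isUnit_w v).pow _)
  · exact Associated.refl _

/-- `(b k) = I(divOf k)_v`: the boundary germ generates the stalk of its divisor. [folklore] -/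
theorem stalkIdeal_divOf_eq_span_b (H : S.EndHyp) {v : V} (hv : v ∈ S.tor) (k : Fin (S.nC v + 1)) :
    stalkIdeal (S.divOf H.endCond hv k).1 v = Ideal.span {S.b H hv k} := by
  rw [S.stalkIdeal_divOf H.endCond hv k, Ideal.span_singleton_eq_span_singleton]
  exact (S.associated_b H hv k).symm

/-- The boundary germs are nonzero. [folklore] -/
theorem b_ne_zero (H : S.EndHyp) {v : V} (hv : v ∈ S.tor) (k : Fin (S.nC v + 1)) : S.b H hv k ≠ 0 :=
  haveI := S.isRegular v
  (S.associated_b H hv k).ne_zero_iff.mpr ((RoundOff.isRsopPart_u S v).ne_zero _)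

/-- The boundary germs lie in `𝔪_v`. [folklore] -/
theorem b_mem (H : S.EndHyp) {v : V} (hv : v ∈ S.tor) (k : Fin (S.nC v + 1)) :
    S.b H hv k ∈ maximalIdeal (V.presheaf.stalk v) := by
  haveI := S.isRegular v
  rw [IsLocalRing.mem_maximalIdeal, mem_nonunits_iff, (S.associated_b H hv k).isUnit_iff,
    ← mem_nonunits_iff, ← IsLocalRing.mem_maximalIdeal]
  exact (RoundOff.isRsopPart_u S v).mem_maximalIdeal _

/-- The boundary germs are part of a regular system of parameters of `𝒪_{V,v}`. [folklore] -/
theorem isRsopPart_b (H : S.EndHyp) {v : V} (hv : v ∈ S.tor) : IsRsopPart (S.b H hv) :=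
  ((RoundOff.isRsopPart_u S v).comp (S.eC hv) (S.eC hv).injective).of_associated
    fun k => (S.associated_b H hv k).symm

/-- **The Kummer relation `yN^p = ∏ (b k)^{aK k}` in `L`.** [folklore] -/
theorem yN_pow (H : S.EndHyp) {v : V} (hv : v ∈ S.tor) :
    S.yN H hv ^ p = algebraMap (V.presheaf.stalk v) L (∏ k, S.b H hv k ^ S.aK H hv k) := by
  rw [(S.normalized_spec H hv).2.2.2.2.2]
  congr 1
  rw [Fin.prod_univ_castSucc, Fin.prod_univ_succ, Fin.prod_univ_succ]
  simp only [tIn, Fin.snoc_castSucc, Fin.snoc_last, b, aK, if_pos, Fin.succ_ne_zero, if_false]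
  have h0 : S.aN H hv (Fin.castSucc 0) = 1 := (S.normalized_spec H hv).2.1
  rw [h0, pow_one, pow_one]
  ring

end Kummer

end GameState

/-- Every exceptional divisor charged at a toroidal point of an end state is one of the enumerated
charged divisors `divOf k` (explicit-binder form, the registered interface of this helper file).
[folklore] -/
theorem gameState_exists_divOf_eq {p : ℕ} {V₀ : Scheme.{0}} [IsIntegral V₀] {L : Type} [Field L]
    [Algebra V₀.functionField L] {V : Scheme.{0}} [IsIntegral V] {π : V ⟶ V₀} [IsDominant π]
    (S : GameState p V₀ L V π) (hend : S.EndCond) {v : V} (hv : v ∈ S.tor) {D : V.IdealSheafData}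
    (hD : S.chargedAt D v) : ∃ k, (S.divOf hend hv k).1 = D :=
  S.exists_divOf_eq hend hv hD

end Summit.ResolutionOfSingularities.ResolutionOfSingularities.Theorems.RadicialJung.CleanModelsSuffice

end
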